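import Mathlib.GroupTheory.Finiteness
import Mathlib.GroupTheory.OrderOfElement
import Mathlib.Data.Fintype.Pigeonhole
import Mathlib.Algebra.BigOperators.Group.List.Basic
import Mathlib.Order.Interval.Finset.Basic
import HarnessLib

/-!
# Every INFINITE finitely generated group has an injective ray with generator steps (König's lemma on minimal words)

builds on p205010 (kernel theorem, internal audit signed; external expert review pending) — nothing in this file uses p205010; pure group
theory / combinatorics, unconditional, no node.
Lane `prim-bschramm`, seat `prim-bschramm-p4` gen 23 (PART C3 of `P4-GENERAL.md` §45).  Helper file (`--supports stmt-CriticalPhenomena-4575 --as helper`).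

THE POINT.  The companion file `CayleyProductCriticalProbLtOne` makes kernel the lemma of Muchnik–Pak ("`A`, `B` infinite finitely generated ⟹
`p_c(A × B) < 1`", via a quadrant `ℤ²₊` inside `Cay(A) □ Cay(B)`) in over-group form and for EVERY generating set.  Its one non-percolation
ingredient is typed here: **`CayleyRay.exists_ray` — if `K = ⟨T⟩` is infinite (`T` finite; torsion groups allowed), there is an injective
`ρ : ℕ → K` with `ρ 0 = 1` and `(ρ n)⁻¹ ρ (n+1) ∈ T ∪ T⁻¹` for all `n`** (a self-avoiding ray of the Cayley graph; in fact a geodesic ray).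
PROOF (König's lemma, hand-rolled).  A MINIMAL word (no word in `T ∪ T⁻¹` with the same product is shorter) has pairwise distinct prefix
products and minimal prefixes; minimal words of every length exist because balls are finite and `K` is infinite (`exists_minWord_length`).  Call
a word EXTENDABLE if it is a prefix of arbitrarily long minimal words; the empty word is extendable, and an extendable word `l` has an extendable
one-letter extension `l ++ [y]` (pigeonhole on the letter following `l` in its long extensions: `Finite.exists_infinite_fiber`).  Iterating
(`choose`) gives an infinite word all of whose prefixes are minimal; its prefix products are the ray.
* §1 words (`exists_letters`), minimal words and their prefixes (`minWord_take`, `minWord_ne_one`, `minWord_prefix_injective`);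
* §2 long minimal words (`exists_minWord_length`); §3 extendable words and **`exists_ray`**; §4 packaged forms (`exists_ray_fg`, `exists_ray_subgroup`,
  `exists_ray_of_not_isOfFinOrder`).  Def-free (proof lane).
[cite: MuchnikPak2001, Lemma 3 and §6 ("choose bi-directed paths … and let the length go to infinity")] [cite: LyonsPeres2016, §7.4 (after Thm. 7.20: Grigorchuk's groups have p_c < 1 by Muchnik–Pak)]
-/

namespace Summit.CriticalPhenomena.PercolationContinuityZ3.Theorems.Transplant

namespace CayleyRay

variable {K : Type*} [Group K] (T : Finset K)

/-! ## §1 Words in `T ∪ T⁻¹`, minimal words and their prefixes -/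

/-- **Every element of `⟨T⟩ = K` is a product of letters from `T ∪ T⁻¹`.** [folklore] -/
theorem exists_letters (hT : Subgroup.closure (T : Set K) = ⊤) (x : K) :
    ∃ l : List K, (∀ y ∈ l, y ∈ T ∨ y⁻¹ ∈ T) ∧ l.prod = x := by
  have hx : x ∈ Subgroup.closure (T : Set K) := by rw [hT]; exact Subgroup.mem_top x
  induction hx using Subgroup.closure_induction with
  | mem y hy => exact ⟨[y], fun z hz => by rw [List.mem_singleton.1 hz]; exact Or.inl (Finset.mem_coe.1 hy), by simp⟩
  | one => exact ⟨[], fun _ h => by simp at h, rfl⟩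
  | mul y z _ _ hy hz =>
    obtain ⟨l₁, hl₁, rfl⟩ := hy
    obtain ⟨l₂, hl₂, rfl⟩ := hz
    exact ⟨l₁ ++ l₂, fun w hw => (List.mem_append.1 hw).elim (hl₁ w) (hl₂ w), List.prod_append⟩
  | inv y _ hy =>
    obtain ⟨l, hl, rfl⟩ := hy
    refine ⟨(l.map fun w => w⁻¹).reverse, fun w hw => ?_, (List.prod_inv_reverse l).symm⟩
    rw [List.mem_reverse, List.mem_map] at hw
    obtain ⟨z, hz, rfl⟩ := hw
    rw [inv_inv]
    exact (hl z hz).symm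

/-- **A minimal word has minimal prefixes**: if no word with the product of `l` is shorter than `l`, the same holds for `l.take k`
(splice a shorter replacement in front of `l.drop k`). [folklore] -/
theorem minWord_take {l : List K} (hl : ∀ y ∈ l, y ∈ T ∨ y⁻¹ ∈ T)
    (hmin : ∀ l' : List K, (∀ y ∈ l', y ∈ T ∨ y⁻¹ ∈ T) → l'.prod = l.prod → l.length ≤ l'.length) (k : ℕ) :
    ∀ l' : List K, (∀ y ∈ l', y ∈ T ∨ y⁻¹ ∈ T) → l'.prod = (l.take k).prod → (l.take k).length ≤ l'.length := by
  intro l' hl' hp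
  have h := hmin (l' ++ l.drop k) (fun y hy => (List.mem_append.1 hy).elim (hl' y) fun h => hl y (List.mem_of_mem_drop h))
    (by rw [List.prod_append, hp, List.prod_take_mul_prod_drop])
  have hlen : l.length = (l.take k).length + (l.drop k).length := by
    conv_lhs => rw [← List.take_append_drop k l]
    rw [List.length_append]
  rw [List.length_append] at h
  omega

/-- **A minimal word has no trivial letter.** [folklore] -/
theorem minWord_ne_one {l : List K} (hl : ∀ y ∈ l, y ∈ T ∨ y⁻¹ ∈ T)
    (hmin : ∀ l' : List K, (∀ y ∈ l', y ∈ T ∨ y⁻¹ ∈ T) → l'.prod = l.prod → l.length ≤ l'.length) :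
    ∀ y ∈ l, y ≠ 1 := by
  intro y hy h1
  subst h1
  obtain ⟨s, t, rfl⟩ := List.append_of_mem hy
  have h := hmin (s ++ t) (fun z hz => hl z (by
      rcases List.mem_append.1 hz with h | h
      · exact List.mem_append_left _ h
      · exact List.mem_append_right _ (List.mem_cons_of_mem _ h)))
    (by rw [List.prod_append, List.prod_append, List.prod_cons, one_mul])
  simp only [List.length_append, List.length_cons] at h
  omega

/-- **A minimal word has pairwise distinct prefix products** (`i ≤ j ≤ |l|`, `∏ l[0,i) = ∏ l[0,j) ⟹ i = j`: otherwise cut out `l[i,j)`).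
[folklore] -/
theorem minWord_prefix_injective {l : List K} (hl : ∀ y ∈ l, y ∈ T ∨ y⁻¹ ∈ T)
    (hmin : ∀ l' : List K, (∀ y ∈ l', y ∈ T ∨ y⁻¹ ∈ T) → l'.prod = l.prod → l.length ≤ l'.length) {i j : ℕ}
    (hij : i ≤ j) (hj : j ≤ l.length) (hp : (l.take i).prod = (l.take j).prod) : i = j := by
  by_contra hne
  have hlt : i < j := lt_of_le_of_ne hij hne
  have h := hmin (l.take i ++ l.drop j)
    (fun y hy => (List.mem_append.1 hy).elim (fun h => hl y (List.mem_of_mem_take h)) fun h => hl y (List.mem_of_mem_drop h))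
    (by rw [List.prod_append, hp, List.prod_take_mul_prod_drop])
  rw [List.length_append, List.length_take, List.length_drop, Nat.min_eq_left (hij.trans hj)] at h
  omega

/-- **Minimal words exist** for every element (a shortest word among the words of `exists_letters`). [folklore] -/
theorem exists_minWord (hT : Subgroup.closure (T : Set K) = ⊤) (x : K) :
    ∃ l : List K, (∀ y ∈ l, y ∈ T ∨ y⁻¹ ∈ T) ∧ l.prod = x ∧
      ∀ l' : List K, (∀ y ∈ l', y ∈ T ∨ y⁻¹ ∈ T) → l'.prod = l.prod → l.length ≤ l'.length := by
  classical
  have hex : ∃ n, ∃ l : List K, (∀ y ∈ l, y ∈ T ∨ y⁻¹ ∈ T) ∧ l.prod = x ∧ l.length = n := by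
    obtain ⟨l, hl, hp⟩ := exists_letters T hT x
    exact ⟨l.length, l, hl, hp, rfl⟩
  obtain ⟨l, hl, hp, hlen⟩ := Nat.find_spec hex
  refine ⟨l, hl, hp, fun l' hl' hp' => ?_⟩
  rw [hlen]
  exact Nat.find_min' hex ⟨l', hl', hp'.trans hp, rfl⟩

/-! ## §2 Long minimal words in an infinite group -/

/-- **An infinite finitely generated group has minimal words of every length**: the products of words of length `< n` form a finite set, an
element outside it has a minimal word of length `≥ n`, and the prefix of length `n` of that word is minimal. [folklore] -/
theorem exists_minWord_length [Infinite K] (hT : Subgroup.closure (T : Set K) = ⊤) (n : ℕ) :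
    ∃ l : List K, (∀ y ∈ l, y ∈ T ∨ y⁻¹ ∈ T) ∧ l.length = n ∧
      ∀ l' : List K, (∀ y ∈ l', y ∈ T ∨ y⁻¹ ∈ T) → l'.prod = l.prod → l.length ≤ l'.length := by
  classical
  -- the alphabet and the finite set of short products
  let A : Finset K := T ∪ T.image (·⁻¹)
  have hA : ∀ y : K, (y ∈ T ∨ y⁻¹ ∈ T) → y ∈ A := fun y hy => by
    rcases hy with h | h
    · exact Finset.mem_union_left _ h
    · exact Finset.mem_union_right _ (Finset.mem_image.2 ⟨y⁻¹, h, inv_inv y⟩)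
  let B : Finset K := (Finset.range n).biUnion fun k =>
    (Finset.univ : Finset (Fin k → A)).image fun w => (List.ofFn fun i => (w i : K)).prod
  have hB : ∀ l : List K, (∀ y ∈ l, y ∈ T ∨ y⁻¹ ∈ T) → l.length < n → l.prod ∈ B := by
    intro l hl hlt
    rw [Finset.mem_biUnion]
    refine ⟨l.length, Finset.mem_range.2 hlt, Finset.mem_image.2 ⟨fun i => ⟨l.get i, hA _ (hl _ (List.get_mem l i))⟩, Finset.mem_univ _, ?_⟩⟩
    show (List.ofFn fun i => l.get i).prod = l.prod
    rw [List.ofFn_get]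
  obtain ⟨x, hx⟩ := Infinite.exists_notMem_finset B
  obtain ⟨l, hl, hp, hmin⟩ := exists_minWord T hT x
  have hn : n ≤ l.length := by
    by_contra h
    exact hx (hp ▸ hB l hl (not_le.1 h))
  refine ⟨l.take n, fun y hy => hl y (List.mem_of_mem_take hy), ?_, minWord_take T hl hmin n⟩
  rw [List.length_take, Nat.min_eq_left hn]

/-! ## §3 Extendable words and the ray -/

/-- **THE RAY (König's lemma).**  If `K = ⟨T⟩` is infinite (`T` finite; torsion allowed) there is an injective `ρ : ℕ → K` with `ρ 0 = 1`
whose consecutive steps `(ρ n)⁻¹ ρ (n+1)` are letters of `T ∪ T⁻¹` — a self-avoiding (indeed geodesic) ray of `Cay(K; T)` from `1`.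
[cite: MuchnikPak2001, Lemma 3 and §6] -/
theorem exists_ray [Infinite K] (hT : Subgroup.closure (T : Set K) = ⊤) :
    ∃ ρ : ℕ → K, ρ 0 = 1 ∧ Function.Injective ρ ∧ ∀ n, (ρ n)⁻¹ * ρ (n + 1) ∈ T ∨ ((ρ n)⁻¹ * ρ (n + 1))⁻¹ ∈ T := by
  classical
  -- letters, minimal words, extendable words
  let Lt : List K → Prop := fun l => ∀ y ∈ l, y ∈ T ∨ y⁻¹ ∈ T
  let Mn : List K → Prop := fun l => Lt l ∧ ∀ l' : List K, Lt l' → l'.prod = l.prod → l.length ≤ l'.length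
  let Ex : List K → Prop := fun l => ∀ n : ℕ, ∃ l' : List K, Mn l' ∧ n ≤ l'.length ∧ l <+: l'
  -- a prefix of a minimal word is minimal
  have hMn_prefix : ∀ l l' : List K, Mn l' → l <+: l' → Mn l := by
    intro l l' hl' hpre
    have e : l = l'.take l.length := (List.prefix_iff_eq_take.1 hpre)
    rw [e]
    exact ⟨fun y hy => hl'.1 y (List.mem_of_mem_take hy), minWord_take T hl'.1 hl'.2 _⟩
  have hEx_Mn : ∀ l, Ex l → Mn l := fun l hl => by
    obtain ⟨l', hl', -, hpre⟩ := hl 0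
    exact hMn_prefix l l' hl' hpre
  -- the empty word is extendable
  have hEx_nil : Ex [] := fun n => by
    obtain ⟨l, hl, hlen, hmin⟩ := exists_minWord_length T hT n
    exact ⟨l, ⟨hl, hmin⟩, hlen.ge, List.nil_prefix⟩
  -- an extendable word has an extendable one-letter extension (pigeonhole on the next letter of its long extensions)
  have hEx_step : ∀ l, Ex l → ∃ y : K, (y ∈ T ∨ y⁻¹ ∈ T) ∧ Ex (l ++ [y]) := by
    intro l hl
    choose ext hext using hl
    -- the letter following `l` in the extension of length `≥ l.length + 1 + m`
    let A : Finset K := T ∪ T.image (·⁻¹)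
    have hA : ∀ y : K, (y ∈ T ∨ y⁻¹ ∈ T) → y ∈ A := fun y hy => by
      rcases hy with h | h
      · exact Finset.mem_union_left _ h
      · exact Finset.mem_union_right _ (Finset.mem_image.2 ⟨y⁻¹, h, inv_inv y⟩)
    have hlen : ∀ m, l.length < (ext (l.length + 1 + m)).length := fun m => by
      have := (hext (l.length + 1 + m)).2.1; omega
    let nx : ℕ → A := fun m => ⟨(ext (l.length + 1 + m))[l.length]'(hlen m),
      hA _ ((hext (l.length + 1 + m)).1.1 _ (List.getElem_mem _))⟩
    obtain ⟨y, hy⟩ := Finite.exists_infinite_fiber nx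
    have hinf : (nx ⁻¹' {y} : Set ℕ).Infinite := Set.infinite_coe_iff.1 hy
    refine ⟨(y : K), ?_, fun n => ?_⟩
    · rcases Finset.mem_union.1 y.2 with h | h
      · exact Or.inl h
      · obtain ⟨z, hz, e⟩ := Finset.mem_image.1 h
        exact Or.inr (by rw [← e, inv_inv]; exact hz)
    · obtain ⟨m, hm, hnm⟩ := hinf.exists_gt n
      have hm' : nx m = y := hm
      refine ⟨ext (l.length + 1 + m), (hext _).1, by have := (hext (l.length + 1 + m)).2.1; omega, ?_⟩
      -- `l ++ [y]` is a prefix of the extension: `l` is, and the next letter is `y`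
      obtain ⟨t, ht⟩ := (hext (l.length + 1 + m)).2.2
      have hy' : (y : K) = (ext (l.length + 1 + m))[l.length]'(hlen m) := by rw [← hm']
      cases t with
      | nil => exfalso; have := hlen m; rw [← ht] at this; simp at this
      | cons z t =>
        refine ⟨t, ?_⟩
        rw [List.append_assoc, List.singleton_append]
        have hz : z = (y : K) := by
          rw [hy']
          simp only [← ht, List.getElem_append_right (le_refl l.length), Nat.sub_self, List.getElem_cons_zero]
        rw [← hz]; exact ht
  -- iterate
  choose! nxt hnxtT hnxtE using hEx_step
  let W : ℕ → List K := fun n => Nat.rec [] (fun _ l => l ++ [nxt l]) n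
  have hW0 : W 0 = [] := rfl
  have hWs : ∀ n, W (n + 1) = W n ++ [nxt (W n)] := fun n => rfl
  have hWE : ∀ n, Ex (W n) := fun n => by
    induction n with
    | zero => exact hEx_nil
    | succ n ih => rw [hWs]; exact hnxtE _ ih
  have hWlen : ∀ n, (W n).length = n := fun n => by
    induction n with
    | zero => rfl
    | succ n ih => rw [hWs, List.length_append, ih]; rfl
  have hWpre : ∀ m n, m ≤ n → W m <+: W n := by
    intro m n hmn
    induction n with
    | zero => rw [Nat.le_zero.1 hmn]
    | succ n ih =>
      rcases Nat.lt_or_eq_of_le hmn with h | h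
      · rw [hWs]; exact (ih (Nat.lt_succ_iff.1 h)).trans (List.prefix_append _ _)
      · rw [h]
  have hWtake : ∀ m n, m ≤ n → (W n).take m = W m := fun m n hmn => by
    have e := List.prefix_iff_eq_take.1 (hWpre m n hmn)
    rw [hWlen] at e
    exact e.symm
  refine ⟨fun n => (W n).prod, by show (W 0).prod = 1; rw [hW0]; rfl, fun i j hij => ?_, fun n => ?_⟩
  · -- injectivity: prefix products of the minimal word `W (max i j)` coincide
    have h : ((W (max i j)).take i).prod = ((W (max i j)).take j).prod := by
      rw [hWtake i _ (le_max_left i j), hWtake j _ (le_max_right i j)]; exact hij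
    have hM := hEx_Mn _ (hWE (max i j))
    rcases le_total i j with hle | hle
    · exact minWord_prefix_injective T hM.1 hM.2 hle (by rw [hWlen]; exact le_max_right i j) h
    · exact (minWord_prefix_injective T hM.1 hM.2 hle (by rw [hWlen]; exact le_max_left i j) h.symm).symm
  · -- steps are the letters `nxt (W n)`
    have e : ((W n).prod)⁻¹ * (W (n + 1)).prod = nxt (W n) := by
      rw [hWs, List.prod_append, List.prod_singleton, inv_mul_cancel_left]
    show ((W n).prod)⁻¹ * (W (n + 1)).prod ∈ T ∨ (((W n).prod)⁻¹ * (W (n + 1)).prod)⁻¹ ∈ T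
    rw [e]
    exact hnxtT _ (hWE n)

/-! ## §4 Packaged forms -/

/-- **Ray in an infinite finitely generated group** (generating set from `Group.FG`), with its finite set of steps. [cite: MuchnikPak2001, Lemma 3] -/
theorem exists_ray_fg [Infinite K] [Group.FG K] :
    ∃ (ρ : ℕ → K) (D : Finset K), ρ 0 = 1 ∧ Function.Injective ρ ∧ ∀ n, (ρ n)⁻¹ * ρ (n + 1) ∈ D := by
  classical
  obtain ⟨T, hT⟩ := Group.fg_def.1 ‹Group.FG K›
  obtain ⟨ρ, h0, hinj, hstep⟩ := exists_ray T hT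
  refine ⟨ρ, T ∪ T.image (·⁻¹), h0, hinj, fun n => ?_⟩
  rcases hstep n with h | h
  · exact Finset.mem_union_left _ h
  · exact Finset.mem_union_right _ (Finset.mem_image.2 ⟨_, h, inv_inv _⟩)

/-- **Ray inside an infinite finitely generated SUBGROUP** `H ≤ Γ`: an injective `ρ : ℕ → Γ` with values in `H`, `ρ 0 = 1`, and steps in a
finite `D ⊆ H`. [cite: MuchnikPak2001, Lemma 3] -/
theorem exists_ray_subgroup {Γ : Type*} [Group Γ] (H : Subgroup Γ) (hH : H.FG) (hinf : (H : Set Γ).Infinite) :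
    ∃ (ρ : ℕ → Γ) (D : Finset Γ), (↑D : Set Γ) ⊆ H ∧ (∀ n, ρ n ∈ H) ∧ ρ 0 = 1 ∧ Function.Injective ρ ∧
      ∀ n, (ρ n)⁻¹ * ρ (n + 1) ∈ D := by
  classical
  haveI : Infinite H := Set.infinite_coe_iff.2 hinf
  haveI : Group.FG H := Group.fg_iff_subgroup_fg _ |>.2 hH
  obtain ⟨ρ, D, h0, hinj, hstep⟩ := exists_ray_fg (K := H)
  refine ⟨fun n => (ρ n : Γ), D.image Subtype.val, fun x hx => ?_, fun n => (ρ n).2, by show ((ρ 0 : H) : Γ) = 1; rw [h0]; rfl,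
    fun i j hij => hinj (Subtype.ext hij), fun n => ?_⟩
  · obtain ⟨y, -, rfl⟩ := Finset.mem_image.1 (Finset.mem_coe.1 hx)
    exact y.2
  · exact Finset.mem_image.2 ⟨_, hstep n, by simp⟩

/-- **Ray along an element of infinite order**: `n ↦ aⁿ`. [folklore] -/
theorem exists_ray_of_not_isOfFinOrder {Γ : Type*} [Group Γ] {a : Γ} (ha : ¬IsOfFinOrder a) :
    ∃ (ρ : ℕ → Γ) (D : Finset Γ), (∀ n, ρ n ∈ Subgroup.zpowers a) ∧ ρ 0 = 1 ∧ Function.Injective ρ ∧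
      ∀ n, (ρ n)⁻¹ * ρ (n + 1) ∈ D := by
  refine ⟨fun n => a ^ n, {a}, fun n => ⟨n, zpow_natCast a n⟩, pow_zero a, injective_pow_iff_not_isOfFinOrder.2 ha, fun n => ?_⟩
  show (a ^ n)⁻¹ * a ^ (n + 1) ∈ ({a} : Finset Γ)
  rw [Finset.mem_singleton, pow_succ, inv_mul_cancel_left]

end CayleyRay

end Summit.CriticalPhenomena.PercolationContinuityZ3.Theorems.Transplant
-- build-touch 2026-08-25T06:37:02Z T1 (lead g18): re-land of p381276, declarations byte-identical
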